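import Mathlib
import Summits.ValiantsHypothesis.ValiantsHypothesis.Theorems.KPlusLogSqLawLiftingLaguerreWindowCalculus

/-!
# Two-sided Descartes–Laguerre rule on an interval, part 2: the Euler operator on tails and window

HONEST FRAMING.  Helper file toward the lifting crux `WeakLifting` (stmt-ValiantsHypothesis-19561; aside `Lifting`
stmt-ValiantsHypothesis-19772, registered stub `stub_liftThin`) of route `KPlusLogSqLaw` (cell `pub-symmetroid`, seat
val-sym-lift-p1 g8, 2026-08-27).  Elementary real analysis about ONE real function on an interval `(a, b)`, `0 < a < b`; nothing
here asserts `WeakLifting`, `TropicalB`, Conjecture B, `MatrixDescartes` (stmt-ValiantsHypothesis-18050) or anything about VP ≠ VNP.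

THIS FILE (tree vocabulary of part 1): `(θ − k)` maps admissible LOW-tail data to minus admissible low-tail data when `k`
exceeds every virtual exponent (`lowEval_euler`), admissible HIGH-tail data to admissible high-tail data when `k` is below every
exponent (`highEval_euler`), and rescales the window coefficient of `x^j` by `j − k` (`winEval_euler`); the derivative of
`y ↦ y^(−k) F(y)` in Euler form; the mean-value consequence «`(θ−k)F ≡ 0` and `F(x₀) ≠ 0` ⇒ `F` zero-free»; the fixed sign pattern of
a tail along the interval (`lowEval_posMul`, `highEval_posMul`); and the assembled ONE-STEP lemma `euler_step` on
`F = σ_L·L + W + σ_H·H`.  No `def`.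
[folklore] (Laguerre's method; quantitative one-variable Descartes theory).
-/

set_option linter.dupNamespace false
set_option autoImplicit false

namespace Summit.ValiantsHypothesis.ValiantsHypothesis.Theorems.KPlusLogSqLaw.LocalDescartes

open Set Finset
open scoped BigOperators
open Literature.Algebra.Polynomial (signVar signVarAux)
open Literature.Computability.AlgebraicComplexity.BD17 (signVar_cons_cons_of_ne_zero)

/-! ## Evaluation of tail data: the Euler operator `θ − k` -/

/-- **`(θ − k)` maps the low class to minus itself** (`k` above every virtual exponent): for admissible low data `L`
(coefficients `≥ 0`, virtual exponents `m + n ≤ e`, `n ≤ 0`) and `k > e` there are admissible low data `L'`, non-trivial iff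
`L` is, with `x·(EL L)'(x) − k·EL L(x) = −EL L'(x)` on `(a,b)`. [folklore] -/
theorem lowEval_euler (a : ℝ) (ha : 0 < a) (e k : ℤ) (hk : e < k) : ∀ (L : List (ℝ × ℤ × ℤ)),
    (∀ t ∈ L, 0 ≤ t.1 ∧ t.2.1 + t.2.2 ≤ e ∧ t.2.2 ≤ 0) →
    ∃ L' : List (ℝ × ℤ × ℤ), (∀ t ∈ L', 0 ≤ t.1 ∧ t.2.1 + t.2.2 ≤ e ∧ t.2.2 ≤ 0) ∧
      ((∃ t ∈ L', 0 < t.1) ↔ (∃ t ∈ L, 0 < t.1)) ∧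
      ∀ x, a < x → HasDerivAt (fun y : ℝ => (L.map (fun t : ℝ × ℤ × ℤ => t.1 * (y ^ t.2.1 * (y - a) ^ t.2.2))).sum)
        (((k : ℝ) * (L.map (fun t : ℝ × ℤ × ℤ => t.1 * (x ^ t.2.1 * (x - a) ^ t.2.2))).sum
          - (L'.map (fun t : ℝ × ℤ × ℤ => t.1 * (x ^ t.2.1 * (x - a) ^ t.2.2))).sum) / x) x
  | [], _ => ⟨[], by simp, by simp, fun x _ => by simpa using hasDerivAt_const x (0 : ℝ)⟩
  | t :: L, hL => by
    obtain ⟨β, m, n⟩ := t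
    have ht := hL (β, m, n) (by simp)
    simp only at ht
    obtain ⟨hβ, hmn, hn⟩ := ht
    obtain ⟨L', hL'adm, hL'flag, hL'der⟩ := lowEval_euler a ha e k hk L
      (fun t' ht' => hL t' (List.mem_cons_of_mem _ ht'))
    refine ⟨(β * ((k : ℝ) - ((m + n : ℤ) : ℝ)), m, n) :: (β * (-(n : ℝ)) * a, m, n - 1) :: L', ?_, ?_, ?_⟩
    · intro t' ht'
      simp only [List.mem_cons] at ht'
      rcases ht' with rfl | rfl | ht'
      · refine ⟨mul_nonneg hβ ?_, hmn, hn⟩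
        have : ((m + n : ℤ) : ℝ) < (k : ℝ) := by exact_mod_cast (lt_of_le_of_lt hmn hk)
        linarith
      · refine ⟨mul_nonneg (mul_nonneg hβ ?_) ha.le, by simp only; omega, by simp only; omega⟩
        have : (n : ℝ) ≤ 0 := by exact_mod_cast hn
        linarith
      · exact hL'adm t' ht'
    · constructor
      · rintro ⟨t', ht'mem, ht'pos⟩
        simp only [List.mem_cons] at ht'mem
        rcases ht'mem with rfl | rfl | ht'mem
        · simp only at ht'pos
          refine ⟨(β, m, n), by simp, ?_⟩
          simp only
          rcases hβ.lt_or_eq with h | h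
          · exact h
          · rw [← h, zero_mul] at ht'pos; exact absurd ht'pos (lt_irrefl 0)
        · simp only at ht'pos
          refine ⟨(β, m, n), by simp, ?_⟩
          simp only
          rcases hβ.lt_or_eq with h | h
          · exact h
          · rw [← h, zero_mul, zero_mul] at ht'pos; exact absurd ht'pos (lt_irrefl 0)
        · obtain ⟨t'', h1, h2⟩ := hL'flag.mp ⟨t', ht'mem, ht'pos⟩
          exact ⟨t'', List.mem_cons_of_mem _ h1, h2⟩
      · rintro ⟨t', ht'mem, ht'pos⟩
        rcases List.mem_cons.mp ht'mem with rfl | ht'mem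
        · simp only at ht'pos
          refine ⟨(β * ((k : ℝ) - ((m + n : ℤ) : ℝ)), m, n), by simp, ?_⟩
          simp only
          have : ((m + n : ℤ) : ℝ) + 1 ≤ (k : ℝ) := by exact_mod_cast (lt_of_le_of_lt hmn hk)
          nlinarith
        · obtain ⟨t'', h1, h2⟩ := hL'flag.mpr ⟨t', ht'mem, ht'pos⟩
          exact ⟨t'', by simp [h1], h2⟩
    · intro x hx
      have h0 : 0 < x := ha.trans hx
      have hd := (hasDerivAt_lowTerm a m n hx h0).const_mul β
      have h := hd.add (hL'der x hx)
      simp only [List.map_cons, List.sum_cons]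
      refine h.congr_deriv ?_
      field_simp
      push_cast
      ring

/-- **`(θ − k)` maps the high class to itself** (`k` below every virtual exponent): for admissible high data `H`
(coefficients `≥ 0`, exponents `m ≥ N`, `n ≤ 0`) and `k < N` there are admissible high data `H'`, non-trivial iff `H` is,
with `x·(EH H)'(x) − k·EH H(x) = EH H'(x)` on `(a,b)`. [folklore] -/
theorem highEval_euler (a b : ℝ) (ha : 0 < a) (N k : ℤ) (hk : k < N) : ∀ (H : List (ℝ × ℤ × ℤ)),
    (∀ t ∈ H, 0 ≤ t.1 ∧ N ≤ t.2.1 ∧ t.2.2 ≤ 0) →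
    ∃ H' : List (ℝ × ℤ × ℤ), (∀ t ∈ H', 0 ≤ t.1 ∧ N ≤ t.2.1 ∧ t.2.2 ≤ 0) ∧
      ((∃ t ∈ H', 0 < t.1) ↔ (∃ t ∈ H, 0 < t.1)) ∧
      ∀ x, a < x → x < b → HasDerivAt (fun y : ℝ => (H.map (fun t : ℝ × ℤ × ℤ => t.1 * (y ^ t.2.1 * (b - y) ^ t.2.2))).sum)
        (((k : ℝ) * (H.map (fun t : ℝ × ℤ × ℤ => t.1 * (x ^ t.2.1 * (b - x) ^ t.2.2))).sum
          + (H'.map (fun t : ℝ × ℤ × ℤ => t.1 * (x ^ t.2.1 * (b - x) ^ t.2.2))).sum) / x) x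
  | [], _ => ⟨[], by simp, by simp, fun x _ _ => by simpa using hasDerivAt_const x (0 : ℝ)⟩
  | t :: H, hH => by
    obtain ⟨β, m, n⟩ := t
    have ht := hH (β, m, n) (by simp)
    simp only at ht
    obtain ⟨hβ, hm, hn⟩ := ht
    obtain ⟨H', hH'adm, hH'flag, hH'der⟩ := highEval_euler a b ha N k hk H
      (fun t' ht' => hH t' (List.mem_cons_of_mem _ ht'))
    refine ⟨(β * ((m : ℝ) - (k : ℝ)), m, n) :: (β * (-(n : ℝ)), m + 1, n - 1) :: H', ?_, ?_, ?_⟩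
    · intro t' ht'
      simp only [List.mem_cons] at ht'
      rcases ht' with rfl | rfl | ht'
      · refine ⟨mul_nonneg hβ ?_, hm, hn⟩
        have : (k : ℝ) < (m : ℝ) := by exact_mod_cast (lt_of_lt_of_le hk hm)
        linarith
      · refine ⟨mul_nonneg hβ ?_, by simp only; omega, by simp only; omega⟩
        have : (n : ℝ) ≤ 0 := by exact_mod_cast hn
        linarith
      · exact hH'adm t' ht'
    · constructor
      · rintro ⟨t', ht'mem, ht'pos⟩
        simp only [List.mem_cons] at ht'mem
        rcases ht'mem with rfl | rfl | ht'mem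
        · simp only at ht'pos
          refine ⟨(β, m, n), by simp, ?_⟩
          simp only
          rcases hβ.lt_or_eq with h | h
          · exact h
          · rw [← h, zero_mul] at ht'pos; exact absurd ht'pos (lt_irrefl 0)
        · simp only at ht'pos
          refine ⟨(β, m, n), by simp, ?_⟩
          simp only
          rcases hβ.lt_or_eq with h | h
          · exact h
          · rw [← h, zero_mul] at ht'pos; exact absurd ht'pos (lt_irrefl 0)
        · obtain ⟨t'', h1, h2⟩ := hH'flag.mp ⟨t', ht'mem, ht'pos⟩
          exact ⟨t'', List.mem_cons_of_mem _ h1, h2⟩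
      · rintro ⟨t', ht'mem, ht'pos⟩
        rcases List.mem_cons.mp ht'mem with rfl | ht'mem
        · simp only at ht'pos
          refine ⟨(β * ((m : ℝ) - (k : ℝ)), m, n), by simp, ?_⟩
          simp only
          have : (k : ℝ) + 1 ≤ (m : ℝ) := by exact_mod_cast (lt_of_lt_of_le hk hm)
          nlinarith
        · obtain ⟨t'', h1, h2⟩ := hH'flag.mpr ⟨t', ht'mem, ht'pos⟩
          exact ⟨t'', by simp [h1], h2⟩
    · intro x hx hxb
      have h0 : 0 < x := ha.trans hx
      have hd := (hasDerivAt_highTerm b m n hxb h0).const_mul β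
      have h := hd.add (hH'der x hx hxb)
      simp only [List.map_cons, List.sum_cons]
      refine h.congr_deriv ?_
      field_simp
      ring

/-- **`(θ − k)` on the Laurent window**: it kills the term `x^k` and rescales `g_j x^j` by `j − k`. [folklore] -/
theorem winEval_euler (a : ℝ) (ha : 0 < a) (k : ℤ) : ∀ (W : List (ℤ × ℝ)),
    ∀ x, a < x → HasDerivAt (fun y : ℝ => (W.map (fun p : ℤ × ℝ => p.2 * y ^ p.1)).sum)
      (((k : ℝ) * (W.map (fun p : ℤ × ℝ => p.2 * x ^ p.1)).sum
        + ((W.map (fun p : ℤ × ℝ => (p.1, ((p.1 : ℝ) - k) * p.2))).map (fun p : ℤ × ℝ => p.2 * x ^ p.1)).sum) / x) x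
  | [], x, _ => by simpa using hasDerivAt_const x (0 : ℝ)
  | p :: W, x, hx => by
    obtain ⟨j, g⟩ := p
    have h0 : 0 < x := ha.trans hx
    have hd : HasDerivAt (fun y : ℝ => g * y ^ j) (g * ((j : ℝ) * x ^ (j - 1))) x :=
      (hasDerivAt_zpow j x (Or.inl h0.ne')).const_mul g
    have h := hd.add (winEval_euler a ha k W x hx)
    simp only [List.map_cons, List.sum_cons, List.map_map]
    simp only [List.map_map] at h
    refine h.congr_deriv ?_
    have ex1 : x ^ j = x ^ (j - 1) * x := by
      rw [← zpow_add_one₀ h0.ne', sub_add_cancel]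
    field_simp
    rw [ex1]
    ring


/-! ## Small analytic and algebraic helpers -/

/-- Euler form of the derivative of `y ↦ y^{−k} F(y)`. [folklore] -/
theorem hasDerivAt_zpow_neg_mul {F : ℝ → ℝ} {F₁ x : ℝ} (k : ℤ) (hF : HasDerivAt F F₁ x) (hx : x ≠ 0) :
    HasDerivAt (fun y : ℝ => y ^ (-k) * F y) (x ^ (-k - 1) * (x * F₁ - (k : ℝ) * F x)) x := by
  have h1 : HasDerivAt (fun y : ℝ => y ^ (-k)) (((-k : ℤ) : ℝ) * x ^ (-k - 1)) x :=
    hasDerivAt_zpow (-k) x (Or.inl hx)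
  have h := h1.fun_mul hF
  refine h.congr_deriv ?_
  have ex : x ^ (-k) = x ^ (-k - 1) * x := by
    rw [← zpow_add_one₀ hx, sub_add_cancel]
  rw [ex]
  push_cast
  ring

/-- If `(y^{−k}F)' = y^{−k−1}·G` with `G ≡ 0` on `(a,b)` and `F(x₀) ≠ 0` for some `x₀ ∈ (a,b)`, then `F` has no zero in
`(a,b)` (mean value theorem). [folklore] -/
theorem ne_zero_of_euler_zero {a b : ℝ} (ha : 0 < a) {F G : ℝ → ℝ} (k : ℤ)
    (hFG : ∀ x ∈ Ioo a b, HasDerivAt (fun y => y ^ (-k) * F y) (x ^ (-k - 1) * G x) x)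
    (hG : ∀ x ∈ Ioo a b, G x = 0) {x₀ : ℝ} (hx₀ : x₀ ∈ Ioo a b) (hF : F x₀ ≠ 0) :
    ∀ z ∈ Ioo a b, F z ≠ 0 := by
  intro z hz hFz
  have key : ∀ u v : ℝ, u ∈ Ioo a b → v ∈ Ioo a b → u < v → u ^ (-k) * F u = v ^ (-k) * F v := by
    intro u v hu hv huv
    have hsub : Icc u v ⊆ Ioo a b := fun y hy => ⟨lt_of_lt_of_le hu.1 hy.1, lt_of_le_of_lt hy.2 hv.2⟩
    have hcont : ContinuousOn (fun y : ℝ => y ^ (-k) * F y) (Icc u v) := fun y hy =>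
      (hFG y (hsub hy)).continuousAt.continuousWithinAt
    obtain ⟨ξ, hξ, hξ'⟩ := exists_hasDerivAt_eq_slope (fun y : ℝ => y ^ (-k) * F y) (fun y => y ^ (-k - 1) * G y)
      huv hcont (fun y hy => hFG y (hsub (Ioo_subset_Icc_self hy)))
    rw [hG ξ (hsub (Ioo_subset_Icc_self hξ)), mul_zero] at hξ'
    have hvu : v - u ≠ 0 := sub_ne_zero.mpr (ne_of_gt huv)
    have := (div_eq_zero_iff.mp hξ'.symm).resolve_right hvu
    linarith
  have hx0 : x₀ ^ (-k) ≠ 0 := zpow_ne_zero _ (ha.trans hx₀.1).ne'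
  rcases lt_trichotomy z x₀ with hlt | heq | hgt
  · have := key z x₀ hz hx₀ hlt
    rw [hFz, mul_zero] at this
    exact hF ((mul_eq_zero.mp this.symm).resolve_left hx0)
  · exact hF (heq ▸ hFz)
  · have := key x₀ z hx₀ hz hgt
    rw [hFz, mul_zero] at this
    exact hF ((mul_eq_zero.mp this).resolve_left hx0)

/-- a value of fixed sign pattern: `u = t · u₀` with `t > 0`, for the low tail at two points of the interval. [folklore] -/
theorem lowEval_posMul (a : ℝ) (ha : 0 < a) (σ : ℝ) (L : List (ℝ × ℤ × ℤ)) (hL : ∀ t ∈ L, 0 ≤ t.1)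
    {x c : ℝ} (hx : a < x) (hc : a < c) :
    ∃ t : ℝ, 0 < t ∧ σ * (L.map (fun t : ℝ × ℤ × ℤ => t.1 * (x ^ t.2.1 * (x - a) ^ t.2.2))).sum
      = t * (σ * (L.map (fun t : ℝ × ℤ × ℤ => t.1 * (c ^ t.2.1 * (c - a) ^ t.2.2))).sum) := by
  obtain ⟨h1, h2⟩ := lowEval_pos_or_zero a L hL
  by_cases hflag : ∃ t ∈ L, 0 < t.1
  · have hxpos := h1 hflag x hx (ha.trans hx)
    have hcpos := h1 hflag c hc (ha.trans hc)
    refine ⟨(L.map (fun t : ℝ × ℤ × ℤ => t.1 * (x ^ t.2.1 * (x - a) ^ t.2.2))).sum /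
      (L.map (fun t : ℝ × ℤ × ℤ => t.1 * (c ^ t.2.1 * (c - a) ^ t.2.2))).sum, div_pos hxpos hcpos, ?_⟩
    rw [mul_left_comm, div_mul_cancel₀ _ hcpos.ne']
  · refine ⟨1, one_pos, ?_⟩
    rw [h2 hflag x, h2 hflag c]; simp

/-- the same for the high tail. [folklore] -/
theorem highEval_posMul (b : ℝ) (σ : ℝ) (H : List (ℝ × ℤ × ℤ)) (hH : ∀ t ∈ H, 0 ≤ t.1)
    {x c : ℝ} (hx : x < b) (h0x : 0 < x) (hc : c < b) (h0c : 0 < c) :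
    ∃ t : ℝ, 0 < t ∧ σ * (H.map (fun t : ℝ × ℤ × ℤ => t.1 * (x ^ t.2.1 * (b - x) ^ t.2.2))).sum
      = t * (σ * (H.map (fun t : ℝ × ℤ × ℤ => t.1 * (c ^ t.2.1 * (b - c) ^ t.2.2))).sum) := by
  obtain ⟨h1, h2⟩ := highEval_pos_or_zero b H hH
  by_cases hflag : ∃ t ∈ H, 0 < t.1
  · have hxpos := h1 hflag x hx h0x
    have hcpos := h1 hflag c hc h0c
    refine ⟨(H.map (fun t : ℝ × ℤ × ℤ => t.1 * (x ^ t.2.1 * (b - x) ^ t.2.2))).sum /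
      (H.map (fun t : ℝ × ℤ × ℤ => t.1 * (c ^ t.2.1 * (b - c) ^ t.2.2))).sum, div_pos hxpos hcpos, ?_⟩
    rw [mul_left_comm, div_mul_cancel₀ _ hcpos.ne']
  · refine ⟨1, one_pos, ?_⟩
    rw [h2 hflag x, h2 hflag c]; simp


/-! ## The Euler step on the whole datum -/

/-- **One `(θ − k)` step on `F = σ_L·L + W + σ_H·H`** (`e < k < N`): new admissible tails `L'`, `H'` (non-trivial iff the old
ones are) such that `(x^{−k} F)' = x^{−k−1} · F'` on `(a,b)` with `F' = (−σ_L)·L' + (θ−k)W + σ_H·H'`, where `(θ − k)W`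
rescales the window coefficient of `x^j` by `j − k`. [folklore] -/
theorem euler_step (a b : ℝ) (ha : 0 < a) (e N : ℤ) (σL σH : ℝ) (L H : List (ℝ × ℤ × ℤ))
    (hL : ∀ t ∈ L, 0 ≤ t.1 ∧ t.2.1 + t.2.2 ≤ e ∧ t.2.2 ≤ 0) (hH : ∀ t ∈ H, 0 ≤ t.1 ∧ N ≤ t.2.1 ∧ t.2.2 ≤ 0)
    (k : ℤ) (hek : e < k) (hkN : k < N) (W : List (ℤ × ℝ)) :
    ∃ L' H' : List (ℝ × ℤ × ℤ),
      (∀ t ∈ L', 0 ≤ t.1 ∧ t.2.1 + t.2.2 ≤ e ∧ t.2.2 ≤ 0) ∧ (∀ t ∈ H', 0 ≤ t.1 ∧ N ≤ t.2.1 ∧ t.2.2 ≤ 0) ∧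
      ((∃ t ∈ L', 0 < t.1) ↔ (∃ t ∈ L, 0 < t.1)) ∧ ((∃ t ∈ H', 0 < t.1) ↔ (∃ t ∈ H, 0 < t.1)) ∧
      ∀ x ∈ Ioo a b, HasDerivAt
        (fun y : ℝ => y ^ (-k) * (σL * (L.map (fun t : ℝ × ℤ × ℤ => t.1 * (y ^ t.2.1 * (y - a) ^ t.2.2))).sum
          + (W.map (fun p : ℤ × ℝ => p.2 * y ^ p.1)).sum
          + σH * (H.map (fun t : ℝ × ℤ × ℤ => t.1 * (y ^ t.2.1 * (b - y) ^ t.2.2))).sum))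
        (x ^ (-k - 1) * ((-σL) * (L'.map (fun t : ℝ × ℤ × ℤ => t.1 * (x ^ t.2.1 * (x - a) ^ t.2.2))).sum
          + ((W.map (fun p : ℤ × ℝ => (p.1, ((p.1 : ℝ) - k) * p.2))).map (fun p : ℤ × ℝ => p.2 * x ^ p.1)).sum
          + σH * (H'.map (fun t : ℝ × ℤ × ℤ => t.1 * (x ^ t.2.1 * (b - x) ^ t.2.2))).sum)) x := by
  obtain ⟨L', hL'adm, hL'flag, hL'der⟩ := lowEval_euler a ha e k hek L hL
  obtain ⟨H', hH'adm, hH'flag, hH'der⟩ := highEval_euler a b ha N k hkN H hH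
  refine ⟨L', H', hL'adm, hH'adm, hL'flag, hH'flag, fun x hx => ?_⟩
  have h0 : 0 < x := ha.trans hx.1
  have hF := (((hL'der x hx.1).const_mul σL).add (winEval_euler a ha k W x hx.1)).add
    ((hH'der x hx.1 hx.2).const_mul σH)
  have h := hasDerivAt_zpow_neg_mul k hF h0.ne'
  refine h.congr_deriv ?_
  simp only [Pi.add_apply]
  set EL := (L.map (fun t : ℝ × ℤ × ℤ => t.1 * (x ^ t.2.1 * (x - a) ^ t.2.2))).sum with hEL
  set ELp := (L'.map (fun t : ℝ × ℤ × ℤ => t.1 * (x ^ t.2.1 * (x - a) ^ t.2.2))).sum with hELp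
  set EW := (W.map (fun p : ℤ × ℝ => p.2 * x ^ p.1)).sum with hEW
  set EWp := ((W.map (fun p : ℤ × ℝ => (p.1, ((p.1 : ℝ) - k) * p.2))).map (fun p : ℤ × ℝ => p.2 * x ^ p.1)).sum
    with hEWp
  set EH := (H.map (fun t : ℝ × ℤ × ℤ => t.1 * (x ^ t.2.1 * (b - x) ^ t.2.2))).sum with hEH
  set EHp := (H'.map (fun t : ℝ × ℤ × ℤ => t.1 * (x ^ t.2.1 * (b - x) ^ t.2.2))).sum with hEHp
  congr 1
  field_simp
  ring

end Summit.ValiantsHypothesis.ValiantsHypothesis.Theorems.KPlusLogSqLaw.LocalDescartes
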